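import Mathlib.AlgebraicGeometry.Geometrically.Irreducible
import Literature.AlgebraicGeometry.GroupSchemes.StrictBirationalGroupLaw
import HarnessLib

/-!
# The glued stage `V′ = V ∪_{W_s} V_s` has geometrically irreducible fibres (Artin, *Néron models*, Lemma 2.4)

Topic `Literature/AlgebraicGeometry/GroupSchemes`, namespace `Literature.AlgebraicGeometry.GroupSchemes`.
KERNEL ONLY: theorems; no definition, no named fact, no instance, no `sorry`.  Cell `hodgecm-mathlib` (D-0151),
road W (Néron capital), piece (G2a″) of the W1c design (`A-provers/A-p06/W1c-DESIGN.A-p06g5.md`, probe v6 currency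
`[GeometricallyIrreducible 𝒳.hom]`): the upgrade of ★ `WeilGluingStep.isPreirreducible_fibre_of_selfGluing`
(preirreducible fibres) to Mathlib's `GeometricallyIrreducible` for the structure map of the glued scheme.

* (private) `irreducibleSpace_of_isOpen_union` — topology: a space covered by two preirreducible subsets which meet,
  the first open, is irreducible. [folklore]
* `geometricallyIrreducible_of_sup_eq_top` — generalise: `f : X ⟶ S` with two opens `U₁ ⊔ U₂ = ⊤`, both
  `Uᵢ ↪ X → S` geometrically irreducible, and `U₁ ⊓ U₂` meeting every fibre ⇒ `f` geometrically irreducible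
  (base change to `Spec K`: `X_K` is covered by the two irreducible opens `(Uᵢ)_K`, which meet over the `K`-point by
  `Scheme.Pullback.exists_preimage_pullback`).
* `geometricallyIrreducible_of_selfGluing` — specialise to Artin's gluing ([Artin1986NeronModels] §2 p. 222 and
  Lemma 2.4 «each fibre of `V′` is irreducible … `V` is dense in each fibre of `V′`»): for `S`-morphisms
  `i₁, i₂ : 𝒱 → 𝒲` which are open immersions, jointly surjective, with `ρ ≫ i₁ = ι_A ≫ i₂`, `𝒱 → S` geometrically
  irreducible and `A` dense in every fibre, `𝒲 → S` is geometrically irreducible.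

Sources: [Artin1986NeronModels] M. Artin, *Néron models*, in Cornell–Silverman, *Arithmetic Geometry* (1986), §2,
Lemma 2.4 (held, `book:cornellnd-arithmetic-geometry` p0293); [BLRNeronModels1990] §5.2 Lemma 5.3 (the same gluing
in Weil's theorem).  HC_CM is not proved here; nothing here changes the floor.
-/

noncomputable section

namespace Literature.AlgebraicGeometry.GroupSchemes

open CategoryTheory CategoryTheory.Limits _root_.AlgebraicGeometry TopologicalSpace

universe u

/-! ## Topology -/

/-- A topological space covered by two preirreducible subsets `W₁, W₂` with non-empty intersection, `W₁` open, is
irreducible. [folklore] -/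
private theorem irreducibleSpace_of_isOpen_union {X : Type*} [TopologicalSpace X] {W₁ W₂ : Set X}
    (hW₁o : IsOpen W₁) (hW₁ : IsPreirreducible W₁) (hW₂ : IsPreirreducible W₂)
    (hcover : W₁ ∪ W₂ = Set.univ) (hne : (W₁ ∩ W₂).Nonempty) : IrreducibleSpace X := by
  obtain ⟨z₀, hz₀⟩ := hne
  haveI : Nonempty X := ⟨z₀⟩
  haveI : PreirreducibleSpace X := by
    refine PreirreducibleSpace.of_forall_nonempty_inter fun U V hU hV hUne hVne => ?_
    -- every non-empty open set meets `W₁`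
    have key : ∀ O : Set X, IsOpen O → O.Nonempty → (W₁ ∩ O).Nonempty := by
      rintro O hO ⟨x, hx⟩
      have hx' : x ∈ W₁ ∪ W₂ := by rw [hcover]; trivial
      rcases hx' with h | h
      · exact ⟨x, h, hx⟩
      · -- `O ∩ W₂` and `W₁ ∩ W₂` are non-empty opens of the preirreducible `W₂`
        obtain ⟨y, hyW₂, hyO, hyW₁⟩ := hW₂ O W₁ hO hW₁o ⟨x, h, hx⟩ ⟨z₀, hz₀.2, hz₀.1⟩
        exact ⟨y, hyW₁, hyO⟩
    obtain ⟨x, -, hxU, hxV⟩ := hW₁ U V hU hV (key U hU hUne) (key V hV hVne)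
    exact ⟨x, hxU, hxV⟩
  exact ⟨‹Nonempty X›⟩

/-! ## Two geometrically irreducible opens which meet in every fibre -/

/-- **Generalised form.**  If `X → S` is covered by two opens `U₁, U₂` such that both `Uᵢ ↪ X → S` are geometrically
irreducible and `U₁ ∩ U₂` meets every fibre of `X → S`, then `X → S` is geometrically irreducible: after base change
to a field `K`, `X_K` is the union of the two irreducible opens `(Uᵢ)_K`, which meet above the `K`-point.
[cite: Artin1986NeronModels, Lemma 2.4 p. 222 (the argument)] -/
theorem geometricallyIrreducible_of_sup_eq_top {X S : Scheme.{u}} (f : X ⟶ S) (U₁ U₂ : X.Opens)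
    (hcover : U₁ ⊔ U₂ = ⊤) [GeometricallyIrreducible (U₁.ι ≫ f)] [GeometricallyIrreducible (U₂.ι ≫ f)]
    (hmeet : ∀ s : S, ∃ x : X, x ∈ U₁ ⊓ U₂ ∧ f.base x = s) : GeometricallyIrreducible f := by
  refine ⟨geometrically_iff_of_isClosedUnderIsomorphisms.mpr fun K _ y => ?_⟩
  -- the base change `Z := X ×_S Spec K` and its two opens `Wᵢ := pr₁ ⁻¹ Uᵢ`
  have hW : ∀ (U : X.Opens) [GeometricallyIrreducible (U.ι ≫ f)],
      IsPreirreducible ((pullback.fst f y).base ⁻¹' (U : Set X)) := by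
    intro U _
    have hirr : IrreducibleSpace ↑(pullback (U.ι ≫ f) y) :=
      pullback_of_geometrically (GeometricallyIrreducible.geometrically_irreducibleSpace (f := U.ι ≫ f)) K y
    have hrange : Set.range (pullback.map (U.ι ≫ f) y f y U.ι (𝟙 _) (𝟙 _) (by simp) (by simp)).base =
        (pullback.fst f y).base ⁻¹' (U : Set X) := by
      have h := Scheme.Pullback.range_map (U.ι ≫ f) y f y U.ι (𝟙 _) (𝟙 _) (by simp) (by simp)
      rw [Scheme.Opens.range_ι] at h
      rw [h]
      simp
    rw [← hrange, ← Set.image_univ]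
    exact (IrreducibleSpace.isIrreducible_univ _).isPreirreducible.image _
      (Scheme.Hom.continuous _).continuousOn
  have hcov : (pullback.fst f y).base ⁻¹' (U₁ : Set X) ∪ (pullback.fst f y).base ⁻¹' (U₂ : Set X) =
      Set.univ := by
    rw [← Set.preimage_union]
    have : (U₁ : Set X) ∪ (U₂ : Set X) = Set.univ := by
      have h := congrArg (fun W : X.Opens => (W : Set X)) hcover
      simpa using h
    rw [this, Set.preimage_univ]
  -- a point of `Z` above a point of `U₁ ∩ U₂` in the fibre of the `K`-point
  obtain ⟨x, hx, hxs⟩ := hmeet (y.base (IsLocalRing.closedPoint K))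
  obtain ⟨z, hz, -⟩ := Scheme.Pullback.exists_preimage_pullback (f := f) (g := y) x
    (IsLocalRing.closedPoint K) hxs
  exact irreducibleSpace_of_isOpen_union ((U₁.isOpen).preimage (Scheme.Hom.continuous _)) (hW U₁) (hW U₂) hcov
    ⟨z, by show (pullback.fst f y).base z ∈ (U₁ : Set X); rw [hz]; exact hx.1,
      by show (pullback.fst f y).base z ∈ (U₂ : Set X); rw [hz]; exact hx.2⟩

/-! ## The glued stage -/

variable {S : Scheme.{u}} (𝒱 : Over S) (A : 𝒱.left.Opens) (ρ : (A : Scheme.{u}) ⟶ 𝒱.left)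

/-- **The glued scheme `V′ = V ∪_{W_s} V_s` is geometrically irreducible over `S`** ([Artin1986NeronModels] §2
p. 222 and Lemma 2.4: «each fibre of `V′` is irreducible, `V` is dense in each fibre of `V′`»; the upgrade of
★ `isPreirreducible_fibre_of_selfGluing` to Mathlib's `GeometricallyIrreducible`, which is the (W1c) v6 stage
invariant).  For `S`-morphisms `i₁, i₂ : 𝒱 → 𝒲` which are open immersions, jointly surjective, with the gluing
relation `ρ ≫ i₁ = ι_A ≫ i₂` of ★ `exists_selfGluing`: if `𝒱 → S` is geometrically irreducible and `A` is dense in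
every fibre of `𝒱 → S`, then `𝒲 → S` is geometrically irreducible — the two copies `i₁(𝒱), i₂(𝒱)` are geometrically
irreducible opens of `𝒲` meeting in `i₂(A)` above every point of `S`. [cite: Artin1986NeronModels, Lemma 2.4 p. 222] -/
theorem geometricallyIrreducible_of_selfGluing {𝒲 : Over S} (i₁ i₂ : 𝒱 ⟶ 𝒲) [IsOpenImmersion i₁.left]
    [IsOpenImmersion i₂.left] (hglue : ρ ≫ i₁.left = A.ι ≫ i₂.left)
    (hcover : Set.range i₁.left.base ∪ Set.range i₂.left.base = Set.univ)
    [GeometricallyIrreducible 𝒱.hom] (hA : IsFibrewiseDense 𝒱.hom (A : Set 𝒱.left)) :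
    GeometricallyIrreducible 𝒲.hom := by
  -- the two copies of `𝒱` as opens of `𝒲`, each geometrically irreducible over `S`
  have hgi : ∀ (i : 𝒱 ⟶ 𝒲) [IsOpenImmersion i.left], GeometricallyIrreducible (i.left.opensRange.ι ≫ 𝒲.hom) := by
    intro i _
    have e : i.left.opensRange.ι ≫ 𝒲.hom = i.left.isoOpensRange.inv ≫ 𝒱.hom := by
      rw [← Over.w i, ← Category.assoc, Scheme.Hom.isoOpensRange_inv_comp]
    rw [e]
    exact (MorphismProperty.cancel_left_of_respectsIso @GeometricallyIrreducible _ _).mpr ‹_›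
  haveI := hgi i₁
  haveI := hgi i₂
  refine geometricallyIrreducible_of_sup_eq_top 𝒲.hom i₁.left.opensRange i₂.left.opensRange
    (Opens.ext (by simpa only [Opens.coe_sup, Scheme.Hom.coe_opensRange, Opens.coe_top] using hcover)) fun s => ?_
  -- a point of `i₂(A) ⊆ i₁(𝒱) ∩ i₂(𝒱)` above `s`
  obtain ⟨v, hv⟩ := 𝒱.hom.surjective s
  obtain ⟨a₀, ha₀A, ha₀s⟩ := hA.nonempty_inter_fibre ⟨v, hv⟩
  have ha₀ : a₀ ∈ Set.range A.ι.base := by rw [Scheme.Opens.range_ι]; exact ha₀A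
  obtain ⟨a, rfl⟩ := ha₀
  refine ⟨i₂.left.base (A.ι.base a), ⟨⟨ρ.base a, ?_⟩, ⟨A.ι.base a, rfl⟩⟩, ?_⟩
  · change (ρ ≫ i₁.left).base a = (A.ι ≫ i₂.left).base a
    rw [hglue]
  · change (i₂.left ≫ 𝒲.hom).base (A.ι.base a) = s
    rw [Over.w i₂]
    exact ha₀s

end Literature.AlgebraicGeometry.GroupSchemes

end
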